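import Literature.Computability.QuantumComplexity.ForrelationCompleteProofs
import Literature.Computability.Cryptography.QubitRegisterCzProofs
import Literature.Computability.Cryptography.QubitRegisterPauliZProofs
import Literature.Computability.Complexity.PromiseProofs
import HarnessLib

/-!
# QSIM over the sign basis `{H, Z, CZ, CCZ}` (Aaronson–Ambainis §6, the basis of Theorem 25)

Topic `Literature/Computability/QuantumComplexity`; fourth file of the decomposition of the named
fact `aaronson_ambainis_kForrelation_complete` (`ForrelationComplete.lean`), after
`ForrelationCompleteProofs.lean` (QSIM over `{H, CCSIGN}` as printed on p. 26, the gadget, the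
steps as named facts), `ForrelationThm25Amplitude.lean` and `ForrelationThm25Instance.lean`
(the amplitude identity `Φ = A_Q` and the instance map of Thm. 25). Source: S. Aaronson,
A. Ambainis, *Forrelation*, SIAM J. Comput. 47 (2018) = arXiv:1411.5729, §6 (pp. 26–27).

## Why a second QSIM

Theorem 25 is stated for phase functions `fᵢ = (-1)^{C}` with "`C` a product of at most `3`
input bits" (p. 27), i.e. for the diagonal gates `Z`, `CZ`, `CCZ` together with the Hadamard
layers; Lemma 24 ("follows from Shi") takes QSIM over `{H, Toffoli}`, "equivalent, under
conjugating the third qubit by Hadamards", to `{H, CCSIGN}` (p. 26). For the *discharge* of the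
completeness fact the intermediate problem is ours to choose, and the sign basis
`{H, Z, CZ, CCZ}` is the one through which both halves are proved in the tree:

* every circuit over Hadamard and `±1`-diagonal gates has all its amplitudes in `2^{-h/2} ℤ`
  (`h` the number of Hadamard gates; a path sum). With `Z` present, `X = HZH`, `CNOT = H·CZ·H`,
  Toffoli `= H·CCZ·H` are exact (`ReversibleCliffordT.lean`: `xWord`, `toffoliWord`). Over
  `{H, CCSIGN}` alone a constant-`|1⟩` wire — hence `Z` and `CZ`, as `CCSIGN` with two resp. one
  control held at `|1⟩` — is exactly available as well (correcting an earlier version of this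
  docstring): the 23-gate `{H, CCSIGN}` word `QSimLift.gadgetOps` of `QSimSignLift.lean` maps
  `|000⟩` to `|001⟩`, whence QSIM over the sign basis Karp-reduces *exactly* to QSIM over
  `{H, CCSIGN}` (`qSimSign_polyTimeReducible_qSim`) and the hardness fact below implies the literal
  one (`AaronsonAmbainis2018_lemma24_hard_of_sign_hard`). What no sign-basis word provides is an
  operator with entries of the mixed types `1` and `1/√2`, such as a controlled-`H`
  (Amy–Glaudell–Ross, Quantum 4 (2020) 252), so the hardness reduction from the tree's Clifford+`T`
  families cannot be literally exact; its discharge (`Lemma24*.lean`) realifies the circuits and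
  injects `T` catalytically from one magic state prepared by a fixed approximate gadget;
* the reduction of Theorem 25 to FORRELATION treats `Z`, `CZ`, `CCZ` uniformly as single phase
  functions of at most three bits, verbatim as printed.

The number `n` of qubits is written in *unary* in the code of an instance (as the ancilla count
in the library's `QCircuit.sigmaEncode`, and for the same reason: a description must be at least
as long as the register it describes, here so that the `O(n)` functions of the parity repair of
`ForrelationThm25Amplitude.lean` are polynomially many in the input length).

## Contents

* `HSignOp`, `hSign` — the gate set `{H, Z, CZ, CCZ}` in the library's `QGateSet` format
  (matrices `hGate`, `pauliZ`, `cz` of `QubitRegister.lean` and `ccsign` of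
  `ForrelationCompleteProofs.lean`), unitary (`hSign_isUnitary`, from the library's discharged
  `pauliZ_mem_unitaryGroup_holds`, `cz_mem_unitaryGroup_holds`) and real
  (`isRealMatrix_toMatrix_sign`);
* `signAmplitude Q = A_Q = ⟨0ⁿ|Q|0ⁿ⟩` (`signAmplitude_coe`, `abs_signAmplitude_le_one`);
* `QSimSignInstance`, `qSimSignProblem` — QSIM over the sign basis as a promise problem over
  `{0,1}` (thresholds `3/5`, `1/100` as on p. 26; codes `⟨1ⁿ, code Q⟩`, injective; disjoint);
* the two halves of the route through it as named facts —
  `AaronsonAmbainis2018_lemma24_sign_hard` (every `PromiseBQP` problem Karp-reduces to it) and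
  `AaronsonAmbainis2018_thm25_sign` (it Karp-reduces to explicit `k`-fold FORRELATION) — and the
  assembly `aaronson_ambainis_kForrelation_complete_of_sign_steps` (with membership,
  `AaronsonAmbainis2018_kForrelation_mem`, and the library's transitivity
  `PolyTimeReducible.trans_holds`).

## References

* S. Aaronson, A. Ambainis, *Forrelation: a problem that optimally separates quantum from
  classical computing*, SIAM J. Comput. 47 (2018) 982–1038; arXiv:1411.5729, §6: p. 26 (QSIM,
  `A_Q`, Lemma 24), p. 27 (Thm. 25: "`fᵢ(x) = (-1)^{C(x)}`, where `C` is a product of at most `3`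
  input bits").
* Y. Shi, *Both Toffoli and controlled-NOT need little help to do universal quantum computing*,
  Quantum Inf. Comput. 3 (2003) 84–92 (`{H, Toffoli}` is universal).
* O. Goldreich, *On promise problems: a survey*, 2006, Def. 1.4 (Karp reductions of promise
  problems).
-/

noncomputable section

namespace Literature.Computability.QuantumComplexity

open Matrix _root_.Computability Complexity Cryptography Finset

/-! ### The gate set `{H, Z, CZ, CCZ}` -/

/-- The gate symbols of the sign basis `{H, Z, CZ, CCZ}`: the Hadamard gate and the diagonal
`±1` gates `(-1)^{z_a}`, `(-1)^{z_a z_b}`, `(-1)^{z_a z_b z_c}` (the phases "`(-1)^{C}`, `C` a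
product of at most `3` input bits" of Thm. 25). [cite: AaronsonAmbainis2018, §6 Thm. 25 (p. 27)] -/
inductive HSignOp
  /-- The Hadamard gate. -/
  | H
  /-- The sign gate `Z : |z⟩ ↦ (-1)^{z}|z⟩`. -/
  | Z
  /-- The controlled-sign gate `CZ : |x,y⟩ ↦ (-1)^{xy}|x,y⟩` (CSIGN). -/
  | CZ
  /-- The controlled-controlled-sign gate `CCZ : |x,y,z⟩ ↦ (-1)^{xyz}|x,y,z⟩` (CCSIGN). -/
  | CCZ
  deriving DecidableEq, Fintype, Inhabited

/-- `HSignOp` is encodable (via `Fin 4`), as needed for the Boolean encoding of circuits. [folklore] -/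
instance : Encodable HSignOp := Encodable.ofEquiv (Fin 4)
  { toFun := fun g => match g with | .H => 0 | .Z => 1 | .CZ => 2 | .CCZ => 3
    invFun := fun i => match i with | 0 => .H | 1 => .Z | 2 => .CZ | 3 => .CCZ
    left_inv := fun g => by cases g <;> rfl
    right_inv := fun i => by fin_cases i <;> rfl }

/-- The sign basis `{H, Z, CZ, CCZ}` (arities `1, 1, 2, 3`) in the library's `QGateSet` format,
with the library's matrices `hGate`, `pauliZ`, `cz` and `ccsign`.
[cite: AaronsonAmbainis2018, §6 (p. 26: H, CSIGN, CCSIGN; p. 27: Thm. 25)] -/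
def hSign : QGateSet where
  Op := HSignOp
  arity
    | .H => 1
    | .Z => 1
    | .CZ => 2
    | .CCZ => 3
  mat
    | .H => hGate
    | .Z => pauliZ
    | .CZ => cz
    | .CCZ => ccsign

/-- The `Encodable` structure on the gate alphabet of `hSign` (transported from `HSignOp`, to
which `hSign.Op` is definitionally equal; cf. `instEncodableOpHCCSign`). [folklore] -/
instance instEncodableOpHSign : Encodable hSign.Op := inferInstanceAs (Encodable HSignOp)

/-- Decidable equality on the gate alphabet of `hSign`. [folklore] -/
instance instDecidableEqOpHSign : DecidableEq hSign.Op := inferInstanceAs (DecidableEq HSignOp)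

/-- The Pauli `Z` gate is real. [folklore] -/
theorem isRealMatrix_pauliZ : IsRealMatrix pauliZ := by
  intro x y
  simp only [pauliZ, Matrix.of_apply]
  split_ifs <;> simp

/-- The controlled-`Z` gate is real. [folklore] -/
theorem isRealMatrix_cz : IsRealMatrix cz := by
  intro x y
  simp only [cz, Matrix.of_apply]
  split_ifs <;> simp

/-- Every gate of a circuit over `{H, Z, CZ, CCZ}` (oracle gates included) is a real matrix.
[cite: AaronsonAmbainis2018, §6 (p. 26)] -/
theorem isRealMatrix_toMatrix_sign_gate {N : ℕ} (A : Language Bool) (g : QGate hSign N) :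
    IsRealMatrix (g.toMatrix A) := by
  rcases g with ⟨g, e⟩ | ⟨m, e⟩
  · rcases g with _ | _ | _ | _
    · exact IsRealMatrix.placeGate e isRealMatrix_hGate
    · exact IsRealMatrix.placeGate e isRealMatrix_pauliZ
    · exact IsRealMatrix.placeGate e isRealMatrix_cz
    · exact IsRealMatrix.placeGate e isRealMatrix_ccsign
  · exact IsRealMatrix.placeGate e (isRealMatrix_oracleGate A m)

/-- The matrix of a circuit over `{H, Z, CZ, CCZ}` is real. [cite: AaronsonAmbainis2018, §6 (p. 26)] -/
theorem isRealMatrix_toMatrix_sign {N : ℕ} (A : Language Bool) (Q : QCircuit hSign N) :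
    IsRealMatrix (Q.toMatrix A) := by
  rcases Q with ⟨gs⟩
  induction gs with
  | nil => simpa using (IsRealMatrix.one : IsRealMatrix (1 : Matrix (QReg N) (QReg N) ℂ))
  | cons g gs ih =>
    rw [QCircuit.toMatrix_cons]
    exact ih.mul (isRealMatrix_toMatrix_sign_gate A g)

/-- The sign basis `{H, Z, CZ, CCZ}` is unitary. [cite: AaronsonAmbainis2018, §6 (p. 26)] -/
theorem hSign_isUnitary : hSign.IsUnitary := by
  rintro (_ | _ | _ | _)
  · change hGate ∈ Matrix.unitaryGroup (QReg 1) ℂ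
    rw [hGate_eq_hGateAll_one]
    exact hGateAll_mem_unitaryGroup_holds 1
  · exact pauliZ_mem_unitaryGroup_holds
  · exact cz_mem_unitaryGroup_holds
  · exact ccsign_mem_unitaryGroup

/-! ### The transition amplitude `A_Q = ⟨0ⁿ|Q|0ⁿ⟩` -/

/-- **The transition amplitude `A_Q := ⟨0ⁿ| Q |0ⁿ⟩`** of an `n`-qubit circuit over the sign basis
(oracle-free semantics `QCircuit.mat`), so that `A_Q²` is the probability that `Q` returns the
all-`0` state to itself; the matrix of `Q` is real, so the real part loses nothing
(`signAmplitude_coe`). [cite: AaronsonAmbainis2018, §6 (p. 26)] -/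
def signAmplitude {N : ℕ} (Q : QCircuit hSign N) : ℝ :=
  (Q.mat (fun _ => false) (fun _ => false)).re

/-- `A_Q` *is* the `⟨0ⁿ|Q|0ⁿ⟩` entry (that entry is real). [cite: AaronsonAmbainis2018, §6 (p. 26)] -/
theorem signAmplitude_coe {N : ℕ} (Q : QCircuit hSign N) :
    (signAmplitude Q : ℂ) = Q.mat (fun _ => false) (fun _ => false) :=
  Complex.ext rfl (by simpa using (isRealMatrix_toMatrix_sign 0 Q _ _).symm)

/-- `|A_Q| ≤ 1`: `A_Q` is an entry of a unitary matrix. [cite: AaronsonAmbainis2018, §6 (p. 26)] -/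
theorem abs_signAmplitude_le_one {N : ℕ} (Q : QCircuit hSign N) : |signAmplitude Q| ≤ 1 := by
  have h := entry_norm_bound_of_unitary
    (QCircuit.toMatrix_mem_unitaryGroup_holds hSign_isUnitary 0 Q) (fun _ => false) (fun _ => false)
  have hc : (signAmplitude Q : ℂ) = Q.toMatrix 0 (fun _ => false) (fun _ => false) := signAmplitude_coe Q
  rwa [← hc, Complex.norm_real, Real.norm_eq_abs] at h

/-- The empty circuit has `A = 1`. [folklore] -/
@[simp] theorem signAmplitude_nil {N : ℕ} : signAmplitude (⟨[]⟩ : QCircuit hSign N) = 1 := by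
  simp [signAmplitude, QCircuit.mat, QCircuit.toMatrix_nil]

/-! ### QSIM over the sign basis as a promise problem -/

/-- An instance of **QSIM over the sign basis**: a number of qubits `n` and an `n`-qubit circuit
over `{H, Z, CZ, CCZ}` (library syntax `QCircuit hSign n`; instances using the syntax's oracle
gates are outside the promise). [cite: AaronsonAmbainis2018, §6 (p. 26)] -/
structure QSimSignInstance where
  /-- Number of qubits. -/
  n : ℕ
  /-- The circuit. -/
  circuit : QCircuit hSign n

namespace QSimSignInstance

/-- The amplitude `A_Q = ⟨0ⁿ|Q|0ⁿ⟩` of an instance. [cite: AaronsonAmbainis2018, §6 (p. 26)] -/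
def amplitude (I : QSimSignInstance) : ℝ :=
  signAmplitude I.circuit

/-- `|A_Q| ≤ 1` for every instance. [cite: AaronsonAmbainis2018, §6 (p. 26)] -/
theorem abs_amplitude_le_one (I : QSimSignInstance) : |I.amplitude| ≤ 1 :=
  abs_signAmplitude_le_one _

/-- Yes-instances: (oracle-free) circuits with `A_Q ≥ 3/5`. [cite: AaronsonAmbainis2018, §6 (p. 26)] -/
def IsYes (I : QSimSignInstance) : Prop :=
  I.circuit.IsOracleFree ∧ 3 / 5 ≤ I.amplitude

/-- No-instances: (oracle-free) circuits with `|A_Q| ≤ 1/100`. [cite: AaronsonAmbainis2018, §6 (p. 26)] -/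
def IsNo (I : QSimSignInstance) : Prop :=
  I.circuit.IsOracleFree ∧ |I.amplitude| ≤ 1 / 100

/-- No instance is both yes and no (`1/100 < 3/5`). [cite: AaronsonAmbainis2018, §6 (p. 26)] -/
theorem not_isNo_of_isYes {I : QSimSignInstance} (h : I.IsYes) : ¬ I.IsNo := by
  rintro ⟨-, hno⟩
  have h1 : I.amplitude ≤ 1 / 100 := (le_abs_self _).trans hno
  linarith [h.2]

/-- Boolean encoding of an instance: `⟨1ⁿ, code of the circuit⟩` — `n` in *unary* (as the
ancilla count of the library's `QCircuit.sigmaEncode`: a description is at least as long as the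
register it describes), the circuit by the library's gate-list encoding `QCircuit.encode`.
[cite: AaronsonAmbainis2018, §6 (p. 26)] -/
def encode (I : QSimSignInstance) : List Bool :=
  boolPair (unaryEncodeNat I.n) I.circuit.encode

/-- The unary numeral of `n` has length `n`. [folklore] -/
theorem length_unaryEncodeNat_eq (n : ℕ) : (unaryEncodeNat n).length = n := by
  induction n with
  | zero => rfl
  | succ n ih => simp [unaryEncodeNat, ih]

/-- The code of an instance is at least as long as twice its number of qubits (unary `n`, every
bit doubled by the pairing). [folklore] -/
theorem two_mul_n_le_length_encode (I : QSimSignInstance) : 2 * I.n ≤ I.encode.length := by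
  rw [encode, length_boolPair, length_unaryEncodeNat_eq]
  omega

/-- The encoding of instances is injective. [folklore] -/
theorem encode_injective : Function.Injective encode := by
  rintro ⟨n, Q⟩ ⟨n', Q'⟩ h
  obtain ⟨h1, h2⟩ := boolPair_inj.1 h
  obtain rfl : n = n' := QCircuit.unaryEncodeNat_injective h1
  obtain rfl : Q = Q' := QCircuit.encode_injective h2
  rfl

end QSimSignInstance

/-- **QSIM over the sign basis** as a promise problem over `{0,1}`: given (the code of) an
`n`-qubit circuit `Q` over `{H, Z, CZ, CCZ}`, decide whether `A_Q ≥ 3/5` (yes) or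
`|A_Q| ≤ 1/100` (no), promised one of these holds. [cite: AaronsonAmbainis2018, §6 (p. 26)] -/
def qSimSignProblem : PromiseProblem :=
  ⟨QSimSignInstance.encode '' {I | I.IsYes}, QSimSignInstance.encode '' {I | I.IsNo}⟩

/-- The code of an instance is a yes-instance iff the instance is. [folklore] -/
@[simp] theorem encode_mem_qSimSignProblem_yes_iff (I : QSimSignInstance) :
    I.encode ∈ qSimSignProblem.yes ↔ I.IsYes :=
  QSimSignInstance.encode_injective.mem_set_image

/-- The code of an instance is a no-instance iff the instance is. [folklore] -/
@[simp] theorem encode_mem_qSimSignProblem_no_iff (I : QSimSignInstance) :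
    I.encode ∈ qSimSignProblem.no ↔ I.IsNo :=
  QSimSignInstance.encode_injective.mem_set_image

/-- QSIM over the sign basis is a genuine (disjoint) promise problem. [cite: AaronsonAmbainis2018, §6 (p. 26)] -/
theorem qSimSignProblem_disjoint : qSimSignProblem.Disjoint := by
  refine Set.disjoint_left.2 ?_
  rintro w ⟨I, hI, rfl⟩ hno
  exact I.not_isNo_of_isYes hI ((encode_mem_qSimSignProblem_no_iff I).1 hno)

/-! ### The route through the sign basis: the two halves as named facts, and the assembly -/

/-- NAMED FACT (**AA Lemma 24, hardness half, over the sign basis; "follows from Shi"**): every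
`PromiseBQP` problem Karp-reduces in polynomial time to QSIM over `{H, Z, CZ, CCZ}`. Printed
argument: `{H, Toffoli}` is universal (Shi 2003), circuits are modified by uncomputing so that
acceptance is returning to `|0ⁿ⟩`, and the gap is amplified to `3/5` vs `1/100`. Over this basis
`X = HZH`, `CNOT = H·CZ·H`, Toffoli `= H·CCZ·H` are exact; the reduction from the tree's
Clifford+`T` families (realification, catalytic `T` injection from one approximately prepared
magic state, amplification before uncomputing — see the module docstring) is the subject of the
`Lemma24*.lean` files. The statement implies the literal one over `{H, CCSIGN}`
(`AaronsonAmbainis2018_lemma24_hard_of_sign_hard`, `QSimSignLift.lean`).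
[cite: AaronsonAmbainis2018, §6 Lemma 24 (p. 26)] -/
def AaronsonAmbainis2018_lemma24_sign_hard : Prop :=
  ∀ Q ∈ PromiseBQP, PromiseProblem.PolyTimeReducible Q qSimSignProblem

/-- NAMED FACT (**AA Lemma 24, membership half, over the sign basis**): QSIM over
`{H, Z, CZ, CCZ}` is in `PromiseBQP` (simulate by a uniform Clifford+`T` family — `Z = S²`,
`CZ`, `CCZ` have exact Clifford+`T` words, `cczWord` of `ReversibleCliffordT.lean` — test the
return to `|0ⁿ⟩`, amplify `9/25` vs `10⁻⁴`). Not used by the assembly below.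
[cite: AaronsonAmbainis2018, §6 Lemma 24 (p. 26)] -/
def AaronsonAmbainis2018_lemma24_sign_mem : Prop :=
  qSimSignProblem ∈ PromiseBQP

/-- NAMED FACT (**AA Theorem 25 over the sign basis, the reduction**): QSIM over
`{H, Z, CZ, CCZ}` Karp-reduces in polynomial time to explicit `k`-fold FORRELATION
(`kForrelationProblem`): every `Z`/`CZ`/`CCZ` gate becomes one phase function `(-1)^{C}` with `C`
a product of at most `3` input bits, every Hadamard gate a CSIGN gadget (p. 27), with the parity
repair of `ForrelationThm25Amplitude.lean`. [cite: AaronsonAmbainis2018, §6 Thm. 25 (p. 27)] -/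
def AaronsonAmbainis2018_thm25_sign : Prop :=
  PromiseProblem.PolyTimeReducible qSimSignProblem kForrelationProblem

/-- **Assembly of §6 through the sign basis.** Membership of explicit `k`-fold FORRELATION in
`PromiseBQP` (p. 26 via Prop. 6, `AaronsonAmbainis2018_kForrelation_mem`), `PromiseBQP`-hardness
of QSIM over `{H, Z, CZ, CCZ}` (Lemma 24) and its reduction to FORRELATION (Thm. 25) give the
vendored completeness statement; transitivity of Karp reductions of promise problems is the
library's `PolyTimeReducible.trans_holds` (Goldreich 2006, Def. 1.4).
[cite: AaronsonAmbainis2018, §6 (Prop. 6, Lemma 24, Thm. 25)] -/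
theorem aaronson_ambainis_kForrelation_complete_of_sign_steps
    (hmem : AaronsonAmbainis2018_kForrelation_mem) (h24 : AaronsonAmbainis2018_lemma24_sign_hard)
    (h25 : AaronsonAmbainis2018_thm25_sign) : aaronson_ambainis_kForrelation_complete :=
  ⟨hmem, fun Q hQ => PromiseProblem.PolyTimeReducible.trans_holds (h24 Q hQ) h25⟩

/-- Conversely, completeness of explicit `k`-fold FORRELATION and membership of QSIM over the
sign basis in `PromiseBQP` give back the reduction of Theorem 25 over that basis.
[cite: AaronsonAmbainis2018, §6 (Lemma 24, Thm. 25)] -/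
theorem AaronsonAmbainis2018_thm25_sign_of_complete (h : aaronson_ambainis_kForrelation_complete)
    (h24 : AaronsonAmbainis2018_lemma24_sign_mem) : AaronsonAmbainis2018_thm25_sign :=
  h.2 _ h24

end Literature.Computability.QuantumComplexity

end
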